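import Summits.QuantumFields.YangMills.Theorems.FlatTubeReductionBOAssemblySlowRate
import HarnessLib

/-!
# The SLOW-WITH-RATE clause from a DRESSED one-site no-intruder (no `W ≤ 1`) — repair of `slow_rate_clause_of_bricks` for `L ≥ 3`
# (route `FlatTubeReduction`, crux K1 `NearFlatRatioLaw` stmt-QuantumFields-24720; seat `ym-line-ftr-p1` g10; R2b1 RECORD rung — no summit statement is proved here)

g9's `RateTube.slow_rate_clause_of_bricks` (p650583) feeds the UNDRESSED one-site inner rate (`oneOrbitRate_one`) with the dressed family `Gᵢ·W` and then uses
`‖G_a W‖² ≤ ‖G_a‖²`, i.e. the hypothesis `W ≤ 1` on the dressed one-site weight `W² = λ_fib(u)/λ_fib(1)`.  For `L ≥ 3` that hypothesis is FALSE for the intended weight: the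
zero-point energy of the NONZERO-momentum (fibre) modes has NEGATIVE curvature at the vacuum (crux workfile `Cruxes/NearFlatRatioLaw/Lines/ratepack-dressing-g10.md` §1:
c_L = −0.36, −0.82, −1.60, −2.90 for L = 3, 4, 6, 10), so `W > 1` off the vacuum, while (B-T)-rate pins `W²` to that ratio.  THIS FILE replaces the pair (`W ≤ 1`, undressed
one-site rate) by ONE hypothesis — the DRESSED one-site no-intruder at the fixed coupling, with the norm UNDRESSED on the right:
  `hDOS`: every admissible `(k+1)`-family `G` of bounded measurable gauge-invariant one-site amplitudes supported in `{orbitDist < δ₁}` with nondegenerate DRESSED Gram matrix has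
  `a ≠ 0` with `⟨G_aW, K_B G_aW⟩·μ₀ ≤ e^{ε'λ}·μ_k·μ₀·‖G_a‖²`
(the min–max levels of `W K_B W` on the window are `≤ e^{ε'λ}μ_k`; at rate grade `ε'λ = C_Dλ_b²`; its proof = cluster absorption + one-site eigenfunction second moments, memo §3).
* ★★★ `slow_rate_clause_of_dressed` — same conclusion as `slow_rate_clause_of_bricks`: `∃ a ≠ 0, tubeForm β (u_a) ≤ e^{ελ/4}·σ·μ_k·tubeNormSq w (u_a)`, `u_a = Σ aᵢ·boProjAd w Ω 𝒰 fᵢ`,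
  from (CA) + (B-N) + (B-T)-rate upper + `hDOS` + lane A's arithmetic; `W` only measurable, gauge invariant and bounded (`|W| ≤ C_W`), any sign of `W² − 1`.
HONEST FRAMING: assembly algebra for the rate twin of a stub of a child of the CONDITIONAL reduction route R2b1; (B-T)-rate and the dressed one-site no-intruder are OPEN; femto rung
at fixed `L`; not infinite volume, not a gap, not Clay.  No defs, no named facts, no `sorry`.
-/

set_option autoImplicit false

noncomputable section

open MeasureTheory Filter Topology Real
open scoped BigOperators
open Literature.MathematicalPhysics.QuantumFieldTheory
open Literature.MathematicalPhysics.QuantumLattice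

namespace Summit.QuantumFields.YangMills.Theorems.FemtoTransferGap.RateTube

open Summit.QuantumFields.YangMills.Theorems.FemtoTransferGap
open Summit.QuantumFields.YangMills.Theorems.FemtoTransferGap.TwoLattice.Avg
open Summit.QuantumFields.YangMills.Theorems.FemtoTransferGap.TwoLattice.ConstTube
open Summit.QuantumFields.YangMills.Theorems.FemtoTransferGap.TwoLattice.Stiff (LinkSpace)

variable {L : ℕ} [NeZero L]

/-! ## ★★★ The SLOW-WITH-RATE clause from the DRESSED one-site no-intruder -/

/-- ★★★ **SLOW-WITH-RATE CLAUSE FROM (B-N), (B-T)-rate AND THE DRESSED ONE-SITE NO-INTRUDER (fixed `β`; adapted fibres; no `W ≤ 1`)**: with (B-N)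
`|fibreMassAd − γ| ≤ κγ` on `𝒰`, (B-T)-rate upper against `⟨φW,K_BφW⟩`, the DRESSED one-site statement `hDOS` with factor `e^{ε'λ}` (norm undressed), and the arithmetic
`(1+κ)e^{ε'λ}μ_k + κμ₀ ≤ (1−κ)e^{ελ/4}μ_k`: `∃ a ≠ 0, tubeForm β (Σaᵢ P fᵢ) ≤ e^{ελ/4}·σμ_k·‖Σaᵢ P fᵢ‖²_w`.  The weight `W` is only measurable, gauge invariant and
bounded (its gauge invariance is not even needed: `hDOS` is applied to the undressed family). [cite: Luscher1983, §3] [cite: SjostrandZworski2007, §2] -/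
theorem slow_rate_clause_of_dressed {β : ℝ} {w : GaugeConfig 3 L SU2 → ℝ} (hw : Measurable w) {Cw : ℝ} (hCw : ∀ U, |w U| ≤ Cw) (hw0 : ∀ U, 0 ≤ w U)
    (hwinv : ∀ (c : SU2) (U : GaugeConfig 3 L SU2), w (gaugeTransform (fun _ : Site 3 L => c) U) = w U)
    {Ω : GaugeConfig 3 1 SU2 → LinkSpace L → ℝ} (hΩ : Measurable (Function.uncurry Ω)) {CΩ : ℝ} (hCΩ : ∀ u x, |Ω u x| ≤ CΩ)
    (hΩinv : ∀ (g : SU2) (u : GaugeConfig 3 1 SU2) (v : LinkSpace L), Ω (gaugeTransform (fun _ : Site 3 1 => g) u) (adL L g v) = Ω u v)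
    {W : GaugeConfig 3 1 SU2 → ℝ} (hWm : Measurable W) {CW : ℝ} (hWb : ∀ u, |W u| ≤ CW)
    {𝒰 : Set (GaugeConfig 3 1 SU2)} (h𝒰 : MeasurableSet 𝒰) (h𝒰inv : ∀ (c : SU2) (u : GaugeConfig 3 1 SU2), gaugeTransform (fun _ : Site 3 1 => c) u ∈ 𝒰 ↔ u ∈ 𝒰)
    {δ₁ : ℝ} (h𝒰δ : ∀ u ∈ 𝒰, orbitDist u < δ₁)
    {σ γ κ : ℝ} (hσ : 0 ≤ σ) (hγ : 0 < γ) (hκ0 : 0 ≤ κ) (hκ1 : κ < 1)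
    (hN : ∀ u ∈ 𝒰, |fibreMassAd L w Ω u - γ| ≤ κ * γ)
    (hT : ∀ φ : GaugeConfig 3 1 SU2 → ℝ, Measurable φ → (∃ C : ℝ, ∀ u, |φ u| ≤ C) → (∀ (g : Site 3 1 → SU2) (u : GaugeConfig 3 1 SU2), φ (gaugeTransform g u) = φ u) →
      (∀ u, φ u ≠ 0 → u ∈ 𝒰) →
      tubeForm β (boFunAd L φ Ω) ≤ σ * γ * (1 + κ) * qform su2Rep ((L : ℝ) ^ 3 * β) (fun u => φ u * W u) (fun u => φ u * W u) +
        κ * σ * γ * levelValue su2Rep 1 ((L : ℝ) ^ 3 * β) 0 * l2 φ φ)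
    {k : ℕ} {ε ε' : ℝ}
    (hDOS : ∀ G : Fin (k + 1) → (GaugeConfig 3 1 SU2 → ℝ), (∀ i, Measurable (G i)) → (∀ i, ∃ C : ℝ, ∀ U, |G i U| ≤ C) →
      (∀ i (g : Site 3 1 → SU2) (U : GaugeConfig 3 1 SU2), G i (gaugeTransform g U) = G i U) → (∀ i U, G i U ≠ 0 → orbitDist U < δ₁) →
      (∀ a : Fin (k + 1) → ℝ, a ≠ 0 → 0 < l2 (fun U => (∑ i, a i * G i U) * W U) (fun U => (∑ i, a i * G i U) * W U)) →
        ∃ a : Fin (k + 1) → ℝ, a ≠ 0 ∧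
          qform su2Rep ((L : ℝ) ^ 3 * β) (fun U => (∑ i, a i * G i U) * W U) (fun U => (∑ i, a i * G i U) * W U) * levelValue su2Rep 1 ((L : ℝ) ^ 3 * β) 0 ≤
            Real.exp (ε' * bareLambda ((L : ℝ) ^ 3 * β)) * levelValue su2Rep 1 ((L : ℝ) ^ 3 * β) k * levelValue su2Rep 1 ((L : ℝ) ^ 3 * β) 0 *
              l2 (fun U => ∑ i, a i * G i U) (fun U => ∑ i, a i * G i U))
    (hμ0 : 0 < levelValue su2Rep 1 ((L : ℝ) ^ 3 * β) 0) (hμk : 0 ≤ levelValue su2Rep 1 ((L : ℝ) ^ 3 * β) k)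
    (harith : (1 + κ) * Real.exp (ε' * bareLambda ((L : ℝ) ^ 3 * β)) * levelValue su2Rep 1 ((L : ℝ) ^ 3 * β) k + κ * levelValue su2Rep 1 ((L : ℝ) ^ 3 * β) 0 ≤
      (1 - κ) * Real.exp (ε / 4 * bareLambda ((L : ℝ) ^ 3 * β)) * levelValue su2Rep 1 ((L : ℝ) ^ 3 * β) k)
    {f : Fin (k + 1) → GaugeConfig 3 L SU2 → ℝ} (hfm : ∀ i, Measurable (f i)) (hfb : ∀ i, ∃ C : ℝ, ∀ U, |f i U| ≤ C) :
    ∃ a : Fin (k + 1) → ℝ, a ≠ 0 ∧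
      tubeForm β (fun U => ∑ i, a i * boProjAd L w Ω 𝒰 (f i) U) ≤
        Real.exp (ε / 4 * bareLambda ((L : ℝ) ^ 3 * β)) * (σ * levelValue su2Rep 1 ((L : ℝ) ^ 3 * β) k) *
          tubeNormSq w (fun U => ∑ i, a i * boProjAd L w Ω 𝒰 (f i) U) := by
  -- abbreviations
  set B : ℝ := (L : ℝ) ^ 3 * β with hB
  set μ0 : ℝ := levelValue su2Rep 1 B 0 with hμ0def
  set μk : ℝ := levelValue su2Rep 1 B k with hμkdef
  set lam : ℝ := bareLambda B with hlamdef
  have hκ1' : 0 < 1 - κ := by linarith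
  -- fibre-mass lower bound on `𝒰`
  have hZ : ∀ u ∈ 𝒰, γ * (1 - κ) ≤ fibreMassAd L w Ω u := fun u hu => by
    have := (abs_le.mp (hN u hu)).1; linarith
  have hZ₀ : 0 < γ * (1 - κ) := mul_pos hγ hκ1'
  -- the one-site amplitudes `φᵢ = boCoeffAd fᵢ` and their colour averages `Gᵢ`
  set φ : Fin (k + 1) → GaugeConfig 3 1 SU2 → ℝ := fun i => boCoeffAd L w Ω 𝒰 (f i) with hφdef
  have hφm : ∀ i, Measurable (φ i) := fun i => measurable_boCoeffAd hw hΩ h𝒰 (hfm i)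
  choose Cf hCf using hfb
  have hφb : ∀ i, ∀ u, |φ i u| ≤ Cf i * CΩ * Cw * (orthoTransverse L).real Set.univ / (γ * (1 - κ)) := fun i =>
    abs_boCoeffAd_le hCw hCΩ hZ₀ hZ (hCf i)
  have hφs : ∀ i u, φ i u ≠ 0 → u ∈ 𝒰 := fun i u hu => by
    by_contra hnu; exact hu (show boCoeffAd L w Ω 𝒰 (f i) u = 0 by unfold boCoeffAd; rw [Set.indicator_of_notMem hnu])
  set G : Fin (k + 1) → GaugeConfig 3 1 SU2 → ℝ := fun i => colourAvg (L := 1) (φ i) with hGdef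
  have hGm : ∀ i, Measurable (G i) := fun i => measurable_colourAvg (hφm i)
  have hGb : ∀ i, ∃ C : ℝ, ∀ U, |G i U| ≤ C := fun i => ⟨_, abs_colourAvg_le (hφm i) (hφb i)⟩
  have hGg : ∀ i (g : Site 3 1 → SU2) (U : GaugeConfig 3 1 SU2), G i (gaugeTransform g U) = G i U := fun i g U => colourAvg_one_site_gaugeInvariant (φ i) g U
  have hGs𝒰 : ∀ i u, G i u ≠ 0 → u ∈ 𝒰 := fun i u hu => by
    by_contra hnu
    exact hu (colourAvg_eq_zero_of_support (S := 𝒰) (fun c v => h𝒰inv c v) (fun v hv => by by_contra h; exact hv (hφs i v h)) hnu)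
  have hGs : ∀ i U, G i U ≠ 0 → orbitDist U < δ₁ := fun i U hU => h𝒰δ U (hGs𝒰 i U hU)
  -- combinations
  have hcombP : ∀ a : Fin (k + 1) → ℝ, (fun U => ∑ i, a i * boProjAd L w Ω 𝒰 (f i) U) = boFunAd L (fun u => ∑ i, a i * φ i u) Ω := fun a => by
    funext U
    rw [← boProjAd_sum hw hCw hΩ hCΩ 𝒰 a hfm (fun i => ⟨Cf i, hCf i⟩) U]
    unfold boProjAd
    rw [boCoeffAd_sum hw hCw hΩ hCΩ 𝒰 a hfm (fun i => ⟨Cf i, hCf i⟩) |> funext |> congrArg (fun φ' => boFunAd L φ' Ω U)]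
  have hφam : ∀ a : Fin (k + 1) → ℝ, Measurable (fun u => ∑ i, a i * φ i u) := fun a => Finset.measurable_sum _ fun i _ => (hφm i).const_mul _
  have hφab : ∀ a : Fin (k + 1) → ℝ, ∀ u, |∑ i, a i * φ i u| ≤ ∑ i, |a i| * (Cf i * CΩ * Cw * (orthoTransverse L).real Set.univ / (γ * (1 - κ))) := fun a u =>
    (Finset.abs_sum_le_sum_abs _ _).trans (Finset.sum_le_sum fun i _ => by rw [abs_mul]; exact mul_le_mul_of_nonneg_left (hφb i u) (abs_nonneg _))
  have hGa : ∀ a : Fin (k + 1) → ℝ, colourAvg (L := 1) (fun u => ∑ i, a i * φ i u) = fun u => ∑ i, a i * G i u := fun a =>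
    funext fun u => colourAvg_sum a hφm (fun i => ⟨_, hφb i⟩) u
  have hGam : ∀ a : Fin (k + 1) → ℝ, Measurable (fun u => ∑ i, a i * G i u) := fun a => Finset.measurable_sum _ fun i _ => (hGm i).const_mul _
  choose CG hCG using hGb
  have hGab : ∀ a : Fin (k + 1) → ℝ, ∀ u, |∑ i, a i * G i u| ≤ ∑ i, |a i| * CG i := fun a u =>
    (Finset.abs_sum_le_sum_abs _ _).trans (Finset.sum_le_sum fun i _ => by rw [abs_mul]; exact mul_le_mul_of_nonneg_left (hCG i u) (abs_nonneg _))
  have hGag : ∀ (a : Fin (k + 1) → ℝ) (g : Site 3 1 → SU2) (u : GaugeConfig 3 1 SU2), (∑ i, a i * G i (gaugeTransform g u)) = ∑ i, a i * G i u := fun a g u =>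
    Finset.sum_congr rfl fun i _ => by rw [hGg]
  have hGas : ∀ (a : Fin (k + 1) → ℝ) u, (∑ i, a i * G i u) ≠ 0 → u ∈ 𝒰 := fun a u hu => by
    by_contra hnu
    exact hu (Finset.sum_eq_zero fun i _ => by
      have : G i u = 0 := by by_contra h; exact hnu (hGs𝒰 i u h)
      rw [this, mul_zero])
  -- the dressed combinations `G_a·W` (bounded measurable)
  have hG'am : ∀ a : Fin (k + 1) → ℝ, Measurable (fun u => (∑ i, a i * G i u) * W u) := fun a => (hGam a).mul hWm
  have hG'ab : ∀ (a : Fin (k + 1) → ℝ) u, |(∑ i, a i * G i u) * W u| ≤ (∑ i, |a i| * CG i) * CW := fun a u => by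
    rw [abs_mul]
    exact mul_le_mul (hGab a u) (hWb u) (abs_nonneg _) ((abs_nonneg _).trans (hGab a u))
  -- the key one-site inequality from the DRESSED no-intruder: `qform(G_a W) ≤ e^{ε'λ} μ_k l2(G_a)` for some `a ≠ 0`
  have hkey : ∃ a : Fin (k + 1) → ℝ, a ≠ 0 ∧
      qform su2Rep B (fun u => (∑ i, a i * G i u) * W u) (fun u => (∑ i, a i * G i u) * W u) ≤
        Real.exp (ε' * lam) * μk * l2 (fun u => ∑ i, a i * G i u) (fun u => ∑ i, a i * G i u) := by
    have hε'0 : 0 ≤ Real.exp (ε' * lam) * μk := mul_nonneg (Real.exp_pos _).le hμk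
    by_cases hnd : ∀ a : Fin (k + 1) → ℝ, a ≠ 0 → 0 < l2 (fun U => (∑ i, a i * G i U) * W U) (fun U => (∑ i, a i * G i U) * W U)
    · obtain ⟨a, ha, h⟩ := hDOS G hGm (fun i => ⟨CG i, hCG i⟩) hGg hGs hnd
      refine ⟨a, ha, ?_⟩
      have h' : qform su2Rep B (fun u => (∑ i, a i * G i u) * W u) (fun u => (∑ i, a i * G i u) * W u) * μ0 ≤
          (Real.exp (ε' * lam) * μk * l2 (fun u => ∑ i, a i * G i u) (fun u => ∑ i, a i * G i u)) * μ0 := by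
        rw [hB, hμ0def, hμkdef, hlamdef]; linarith [h]
      exact le_of_mul_le_mul_right h' hμ0
    · push Not at hnd
      obtain ⟨a, ha, hle⟩ := hnd
      refine ⟨a, ha, ?_⟩
      have h0 : l2 (fun u => (∑ i, a i * G i u) * W u) (fun u => (∑ i, a i * G i u) * W u) = 0 := le_antisymm hle (l2_self_nonneg_lat _)
      have hsq : ∫ U, ((∑ i, a i * G i U) * W U) ^ 2 ∂configMeasure SU2 1 = 0 := by rw [← l2_self_eq_integral_sq]; exact h0
      rw [qform_eq_zero_of_integral_sq_eq_zero B (hG'am a) (hG'ab a) hsq]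
      exact mul_nonneg hε'0 (l2_self_nonneg_lat _)
  obtain ⟨a, ha, hqa⟩ := hkey
  refine ⟨a, ha, ?_⟩
  -- form side: colour average, then the kernel brick (against the DRESSED one-site form)
  have hPm : Measurable (boFunAd L (fun u => ∑ i, a i * φ i u) Ω) := measurable_boFunAd L (hφam a) hΩ
  have hPb := abs_boFunAd_le L (hφab a) hCΩ
  have hform : tubeForm β (fun U => ∑ i, a i * boProjAd L w Ω 𝒰 (f i) U) ≤
      σ * γ * (1 + κ) * qform su2Rep B (fun u => (∑ i, a i * G i u) * W u) (fun u => (∑ i, a i * G i u) * W u) +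
        κ * σ * γ * μ0 * l2 (fun u => ∑ i, a i * G i u) (fun u => ∑ i, a i * G i u) := by
    rw [hcombP a, ← tubeForm_colourAvg β hPm hPb]
    have hc : colourAvg (boFunAd L (fun u => ∑ i, a i * φ i u) Ω) = boFunAd L (fun u => ∑ i, a i * G i u) Ω := by
      funext U; rw [colourAvg_boFunAd L _ hΩinv U, hGa a]
    rw [hc]
    exact hT _ (hGam a) ⟨_, hGab a⟩ (hGag a) (hGas a)
  -- norm side: colour average does not increase the norm; fibre mass ≥ γ(1−κ)
  have hnorm : γ * (1 - κ) * l2 (fun u => ∑ i, a i * G i u) (fun u => ∑ i, a i * G i u) ≤ tubeNormSq w (fun U => ∑ i, a i * boProjAd L w Ω 𝒰 (f i) U) := by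
    rw [hcombP a]
    have h1 : tubeNormSq w (colourAvg (boFunAd L (fun u => ∑ i, a i * φ i u) Ω)) ≤ tubeNormSq w (boFunAd L (fun u => ∑ i, a i * φ i u) Ω) :=
      tubeNormSq_colourAvg_le hw hCw hw0 hwinv hPm hPb
    have hc : colourAvg (boFunAd L (fun u => ∑ i, a i * φ i u) Ω) = boFunAd L (fun u => ∑ i, a i * G i u) Ω := by
      funext U; rw [colourAvg_boFunAd L _ hΩinv U, hGa a]
    rw [hc, tubeNormSq_boFunAd (hGam a) (hGab a) hΩ hCΩ hw hCw] at h1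
    refine le_trans ?_ h1
    rw [l2_self_eq_integral_sq, ← integral_const_mul]
    have hiL : Integrable (fun u => γ * (1 - κ) * (∑ i, a i * G i u) ^ 2) (configMeasure SU2 1) :=
      (integrable_of_measurable_abs_le _ ((hGam a).pow_const 2) (C := (∑ i, |a i| * CG i) ^ 2) fun u => by
        rw [abs_pow]; exact pow_le_pow_left₀ (abs_nonneg _) (hGab a u) 2).const_mul _
    have hM := measurable_fibreMassAd hw hΩ (L := L)
    have hMb : ∀ u, |fibreMassAd L w Ω u| ≤ CΩ ^ 2 * Cw * (orthoTransverse L).real Set.univ := fun u => by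
      haveI := isFiniteMeasure_orthoTransverse L
      unfold fibreMassAd
      have hCΩ0 : 0 ≤ CΩ := (abs_nonneg _).trans (hCΩ 1 0)
      calc |∫ v, Ω u (linkEmbed L v) ^ 2 * w (orthoTube L u v) ∂orthoTransverse L| ≤ ∫ v, |Ω u (linkEmbed L v) ^ 2 * w (orthoTube L u v)| ∂orthoTransverse L :=
            abs_integral_le_integral_abs
        _ ≤ ∫ _v, CΩ ^ 2 * Cw ∂orthoTransverse L := by
            refine integral_mono_of_nonneg (ae_of_all _ fun v => abs_nonneg _) (integrable_const _) (ae_of_all _ fun v => ?_)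
            show |Ω u (linkEmbed L v) ^ 2 * w (orthoTube L u v)| ≤ CΩ ^ 2 * Cw
            rw [abs_mul, abs_pow]
            exact mul_le_mul (pow_le_pow_left₀ (abs_nonneg _) (hCΩ _ _) 2) (hCw _) (abs_nonneg _) (by positivity)
        _ = CΩ ^ 2 * Cw * (orthoTransverse L).real Set.univ := by rw [integral_const, smul_eq_mul, mul_comm]
    have hiR : Integrable (fun u => (∑ i, a i * G i u) ^ 2 * fibreMassAd L w Ω u) (configMeasure SU2 1) :=
      integrable_of_measurable_abs_le _ (((hGam a).pow_const 2).mul hM) (C := (∑ i, |a i| * CG i) ^ 2 * (CΩ ^ 2 * Cw * (orthoTransverse L).real Set.univ))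
        fun u => by rw [abs_mul, abs_pow]; exact mul_le_mul (pow_le_pow_left₀ (abs_nonneg _) (hGab a u) 2) (hMb u) (abs_nonneg _) (by positivity)
    refine integral_mono hiL hiR fun u => ?_
    dsimp only
    by_cases hu : u ∈ 𝒰
    · have := hZ u hu; nlinarith [sq_nonneg (∑ i, a i * G i u)]
    · have h0 : (∑ i, a i * G i u) = 0 := by by_contra h; exact hu (hGas a u h)
      rw [h0]; simp
  -- arithmetic
  have hl2 : 0 ≤ l2 (fun u => ∑ i, a i * G i u) (fun u => ∑ i, a i * G i u) := l2_self_nonneg_lat _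
  set n := l2 (fun u => ∑ i, a i * G i u) (fun u => ∑ i, a i * G i u) with hndef
  have h1 : tubeForm β (fun U => ∑ i, a i * boProjAd L w Ω 𝒰 (f i) U) ≤ σ * γ * ((1 + κ) * Real.exp (ε' * lam) * μk + κ * μ0) * n := by
    have := mul_le_mul_of_nonneg_left hqa (by positivity : 0 ≤ σ * γ * (1 + κ))
    nlinarith [hform, this]
  have h2 : σ * γ * ((1 + κ) * Real.exp (ε' * lam) * μk + κ * μ0) * n ≤ σ * γ * ((1 - κ) * Real.exp (ε / 4 * lam) * μk) * n :=
    mul_le_mul_of_nonneg_right (mul_le_mul_of_nonneg_left harith (by positivity)) hl2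
  have h3 : σ * γ * ((1 - κ) * Real.exp (ε / 4 * lam) * μk) * n = Real.exp (ε / 4 * lam) * (σ * μk) * (γ * (1 - κ) * n) := by ring
  have h4 : Real.exp (ε / 4 * lam) * (σ * μk) * (γ * (1 - κ) * n) ≤
      Real.exp (ε / 4 * lam) * (σ * μk) * tubeNormSq w (fun U => ∑ i, a i * boProjAd L w Ω 𝒰 (f i) U) :=
    mul_le_mul_of_nonneg_left hnorm (by positivity)
  linarith [h1, h2, h3, h4]

end Summit.QuantumFields.YangMills.Theorems.FemtoTransferGap.RateTube

end
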